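import Summits.QuantumFields.YangMills.Theorems.ConvexGribovBodyBrascampLiebVacuumSCCubeWitnessOfDimensionGap

/-!
# Crux `BrascampLiebVacuumSC` (stmt-QuantumFields-16404), line `SketchIdeator1`, skeleton v7:
# the Haar covering/packing sandwich (`stub_haarSandwich`)

For a compact group `G` with a faithful continuous unitary matrix representation `r`
(`ρ = r.ρ : G →* M_N(ℂ)`), Haar probability measure `μ = haarProbability G` and the Frobenius balls
`B_ε = {g : froSq (ρ g − 1) < ε²}` (`froSq` the squared Frobenius norm):

* if finitely many points `T` form an `ε`-net of `G` in the pulled-back Frobenius distance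
  (`∀ g, ∃ x ∈ T, froSq (ρ g − ρ x) < ε²`) then `1 ≤ |T| · μ(B_ε)`;
* if the points of `T` are pairwise `≥ 2ε` apart (`(2ε)² ≤ froSq (ρ x − ρ y)` for `x ≠ y` in `T`)
  then `|T| · μ(B_ε) ≤ 1`.

Proof. The ball `{g : froSq (ρ g − ρ x) < ε²}` around `ρ x` is the preimage of `B_ε` under
`g ↦ x⁻¹ g` (`ρ(x⁻¹ g) − 1 = ρ(x⁻¹) (ρ g − ρ x)` and `froSq` is invariant under left multiplication
by a unitary), so it has measure `μ(B_ε)` by left invariance of `μ`. An `ε`-net makes these translates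
cover `G`, whence `1 = μ(G) ≤ Σ_{x ∈ T} μ(translate) = |T| μ(B_ε)`; `2ε`-separation makes them pairwise
disjoint (`froSq (X + Y) ≤ 2 froSq X + 2 froSq Y` gives `froSq (ρ x − ρ y) < 4 ε²` at a common point),
whence `|T| μ(B_ε) = μ(⋃ translates) ≤ μ(G) = 1`. Everything is proved; no named facts.
-/

set_option autoImplicit false

open scoped BigOperators Topology Matrix ENNReal
open Filter MeasureTheory
open Literature.MathematicalPhysics.QuantumFieldTheory
open Summit.QuantumFields.YangMills.Cruxes.CovarianceBound.SupportWindow (froSq)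

noncomputable section

namespace Summit.QuantumFields.YangMills.Theorems.BrascampLiebVacuumSC

namespace HaarSandwich

variable {G : Type} [Group G] [TopologicalSpace G]

/-- Left invariance of the pulled-back Frobenius distance:
`froSq (ρ (x⁻¹ g) − 1) = froSq (ρ g − ρ x)` (`ρ (x⁻¹ g) − 1 = ρ x⁻¹ (ρ g − ρ x)`, `ρ x⁻¹` unitary).
[folklore] -/
theorem froSq_inv_mul_sub_one (r : LatticeRep G) (x g : G) :
    froSq (r.ρ (x⁻¹ * g) - 1) = froSq (r.ρ g - r.ρ x) := by
  have h1 : r.ρ x⁻¹ * r.ρ x = 1 := by rw [← map_mul, inv_mul_cancel, map_one]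
  have h : r.ρ (x⁻¹ * g) - 1 = r.ρ x⁻¹ * (r.ρ g - r.ρ x) := by
    rw [mul_sub, h1, map_mul]
  rw [h, GaugeAlgebra.froSq_unitary_mul (r.mem_unitary _)]

/-- The Frobenius ball around `ρ x` is the left translate by `x` of the ball around `1`:
`{g : froSq (ρ g − ρ x) < c} = (g ↦ x⁻¹ g)⁻¹' {h : froSq (ρ h − 1) < c}`. [folklore] -/
theorem froBall_eq_preimage (r : LatticeRep G) (x : G) (c : ℝ) :
    {g : G | froSq (r.ρ g - r.ρ x) < c} =
      (fun g => x⁻¹ * g) ⁻¹' {h : G | froSq (r.ρ h - 1) < c} := by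
  ext g
  simp only [Set.mem_setOf_eq, Set.mem_preimage, froSq_inv_mul_sub_one]

/-- The Frobenius balls `{g : froSq (ρ g − ρ x) < c}` are open (continuity of `ρ` and of `froSq`).
[folklore] -/
theorem isOpen_froBall (r : LatticeRep G) (x : G) (c : ℝ) :
    IsOpen {g : G | froSq (r.ρ g - r.ρ x) < c} :=
  isOpen_lt
    (Summit.QuantumFields.YangMills.Cruxes.CovarianceBound.SupportWindow.SupMeasurable.continuous_froSq.comp
      (r.continuous.sub continuous_const)) continuous_const

/-- The triangle inequality in squared form: two Frobenius balls of squared radius `ε²` around `ρ x`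
and `ρ y` with a common point `ρ g` force `froSq (ρ x − ρ y) < (2ε)²`
(`ρ x − ρ y = −(ρ g − ρ x) + (ρ g − ρ y)` and `froSq (X + Y) ≤ 2 froSq X + 2 froSq Y`). [folklore] -/
theorem froSq_sub_lt_of_mem_froBall (r : LatticeRep G) {ε : ℝ} {x y g : G}
    (hx : froSq (r.ρ g - r.ρ x) < ε ^ 2) (hy : froSq (r.ρ g - r.ρ y) < ε ^ 2) :
    froSq (r.ρ x - r.ρ y) < (2 * ε) ^ 2 := by
  have hdec : r.ρ x - r.ρ y = -(r.ρ g - r.ρ x) + (r.ρ g - r.ρ y) := by abel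
  calc froSq (r.ρ x - r.ρ y)
      ≤ 2 * froSq (-(r.ρ g - r.ρ x)) + 2 * froSq (r.ρ g - r.ρ y) := by
        rw [hdec]; exact GaugeAlgebra.froSq_add_le _ _
    _ = 2 * froSq (r.ρ g - r.ρ x) + 2 * froSq (r.ρ g - r.ρ y) := by
        rw [DimensionGap.froSq_neg]
    _ < 2 * ε ^ 2 + 2 * ε ^ 2 := by gcongr
    _ = (2 * ε) ^ 2 := by ring

variable [IsTopologicalGroup G] [CompactSpace G] [MeasurableSpace G] [BorelSpace G]

/-- Left invariance of the Haar probability measure: every translate ball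
`{g : froSq (ρ g − ρ x) < c}` has the measure of the ball `{g : froSq (ρ g − 1) < c}` around `1`.
[folklore] -/
theorem measure_froBall_eq (r : LatticeRep G) (x : G) (c : ℝ) :
    haarProbability G {g : G | froSq (r.ρ g - r.ρ x) < c} =
      haarProbability G {g : G | froSq (r.ρ g - 1) < c} := by
  rw [froBall_eq_preimage, measure_preimage_mul]

end HaarSandwich

open HaarSandwich

/-- **Haar covering/packing sandwich** (`stub_haarSandwich` of skeleton v7 of the line `SketchIdeator1`).
For a compact group `G` with a faithful continuous unitary matrix representation `r`, Haar probability
measure `μ` and the Frobenius balls `B_ε = {g : froSq (ρ g − 1) < ε²}`: if finitely many points `T`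
form an `ε`-net of `G` (`∀ g, ∃ x ∈ T, froSq (ρ g − ρ x) < ε²`) then `1 ≤ |T| · μ(B_ε)` (the translates
`{g : froSq (ρ g − ρ x) < ε²} = x · B_ε`, `x ∈ T`, cover `G`, and each has measure `μ(B_ε)` by left
invariance of `μ` and unitary invariance of `froSq`); if the points of `T` are pairwise `≥ 2ε` apart
(`(2ε)² ≤ froSq (ρ x − ρ y)`) then `|T| · μ(B_ε) ≤ 1` (the translates are pairwise disjoint by the
triangle inequality `froSq (X + Y) ≤ 2 froSq X + 2 froSq Y`). [folklore] -/
theorem stub_haarSandwich :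
    ∀ (G : Type) [Group G] [TopologicalSpace G] [IsTopologicalGroup G] [CompactSpace G]
    [MeasurableSpace G] [BorelSpace G] (r : LatticeRep G) (ε : ℝ) (T : Finset G), 0 < ε →
      ((∀ g : G, ∃ x ∈ T, froSq (r.ρ g - r.ρ x) < ε ^ 2) →
        1 ≤ (T.card : ℝ) * (haarProbability G {g : G | froSq (r.ρ g - 1) < ε ^ 2}).toReal) ∧
      ((∀ x ∈ T, ∀ y ∈ T, x ≠ y → (2 * ε) ^ 2 ≤ froSq (r.ρ x - r.ρ y)) →
        (T.card : ℝ) * (haarProbability G {g : G | froSq (r.ρ g - 1) < ε ^ 2}).toReal ≤ 1) := by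
  intro G _ _ _ _ _ _ r ε T _hε
  classical
  set μ : Measure G := haarProbability G with hμ
  set B : Set G := {g : G | froSq (r.ρ g - 1) < ε ^ 2} with hB
  set S : G → Set G := fun x => {g : G | froSq (r.ρ g - r.ρ x) < ε ^ 2} with hS
  -- every translate has the measure of the ball around `1`
  have hSμ : ∀ x, μ (S x) = μ B := fun x => measure_froBall_eq r x (ε ^ 2)
  have hsum : ∑ x ∈ T, μ (S x) = (T.card : ℝ≥0∞) * μ B := by
    simp only [hSμ, Finset.sum_const, nsmul_eq_mul]
  have hne : (T.card : ℝ≥0∞) * μ B ≠ ∞ :=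
    ENNReal.mul_ne_top (ENNReal.natCast_ne_top _) (measure_ne_top _ _)
  have hreal : ((T.card : ℝ≥0∞) * μ B).toReal = (T.card : ℝ) * (μ B).toReal := by
    rw [ENNReal.toReal_mul, ENNReal.toReal_natCast]
  refine ⟨fun hnet => ?_, fun hsep => ?_⟩
  · -- covering: the translates cover `G`
    have hcov : (Set.univ : Set G) ⊆ ⋃ x ∈ T, S x := by
      intro g _
      obtain ⟨x, hx, hgx⟩ := hnet g
      exact Set.mem_iUnion₂.2 ⟨x, hx, hgx⟩
    have h1 : (1 : ℝ≥0∞) ≤ (T.card : ℝ≥0∞) * μ B :=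
      calc (1 : ℝ≥0∞) = μ Set.univ := measure_univ.symm
        _ ≤ μ (⋃ x ∈ T, S x) := measure_mono hcov
        _ ≤ ∑ x ∈ T, μ (S x) := measure_biUnion_finset_le T S
        _ = (T.card : ℝ≥0∞) * μ B := hsum
    have h2 := ENNReal.toReal_mono hne h1
    rwa [ENNReal.toReal_one, hreal] at h2
  · -- packing: the translates are pairwise disjoint
    have hdisj : Set.PairwiseDisjoint (↑T : Set G) S := by
      intro x hx y hy hxy
      rw [Function.onFun, Set.disjoint_left]
      intro g hgx hgy
      exact absurd (hsep x hx y hy hxy) (not_le.2 (froSq_sub_lt_of_mem_froBall r hgx hgy))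
    have h1 : (T.card : ℝ≥0∞) * μ B ≤ 1 :=
      calc (T.card : ℝ≥0∞) * μ B = ∑ x ∈ T, μ (S x) := hsum.symm
        _ = μ (⋃ x ∈ T, S x) :=
          (measure_biUnion_finset hdisj fun x _ => (isOpen_froBall r x _).measurableSet).symm
        _ ≤ μ Set.univ := measure_mono (Set.subset_univ _)
        _ = 1 := measure_univ
    have h2 := ENNReal.toReal_mono ENNReal.one_ne_top h1
    rwa [ENNReal.toReal_one, hreal] at h2

end Summit.QuantumFields.YangMills.Theorems.BrascampLiebVacuumSC

end
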